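import Literature.AnabelianGeometry.SemiGraphs.TemperedCompactPairInteriorInfiniteValence
import Literature.AnabelianGeometry.SemiGraphs.TemperedCompactPairTwoStep
import Literature.AnabelianGeometry.SemiGraphs.TemperedVerticialMaximalCompactOfElevation
import HarnessLib

/-!
# Two compact subgroups of `π₁^temp(𝒢)` at a SPARSE graph (no closed edge joins two vertices of infinite
# valence): jointly compact or ANCHORED — the three open ∀-pieces of [SemiAnbd] Thm 3.7 (iv) OUTRIGHT for the class

Mochizuki, *Semi-graphs of anabelioids*, Publ. RIMS **42** (2006), §3, Theorem 3.7 (iv) p. 41: "The maximal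
compact subgroups of `π₁^temp(𝒢)` are precisely the verticial subgroups. The nontrivial intersections of two distinct
maximal compact subgroups of `π₁^temp(𝒢)` are precisely the edge-like subgroups." [cite: MochizukiSemiAnbd2006, Thm 3.7(iv) p.41].

PROOF-ONLY tool file (abc-iut cell, layer L3, row «T37iv-S2@SPARSE-CLASS», file F9b, seat abc-iut-L3-t8 gen 11;
no definition, no named fact).  Canonical chart of ANY countable `𝒢` with the hypotheses of Thm 3.7.  Call `𝒢`
*sparse* (a hypothesis binder below, not a definition) if of any two branches `b ≠ b'` of one edge abutting to
vertices `v`, `v'` at least one of `v`, `v'` has finitely many branches — every locally finite graph, every star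
of finite graphs, the rayless star `𝒢⋆(p)` of abc-iut-L3-t8 gen 6–9.  By F8 (`exists_twoStep_or_adjacent_infinite_valence`)
the third regime of the trichotomy then lives at tree distance EXACTLY TWO at every level, and by F9a
(`anchored_of_forall_exists_twoStep`) it is anchored:

* ★★ `isCompact_or_anchored_of_sparse` — at a SPARSE Thm-3.7 graph two compact subgroups meeting non-trivially
  generate a compact subgroup or are ANCHORED (the locally finite class theorem
  `isCompact_or_anchored_of_isLocallyFinite` of F4 extended to the sparse class; `sparse_of_isLocallyFinite`);
* ★★ the three ∀-pieces of (iv) OUTRIGHT for sparse graphs: `exists_verticial_ge_of_inf_verticial_ne_bot_of_sparse`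
  (ANCHORED PACKAGE: no exotic compact subgroup meets a verticial subgroup non-trivially),
  `le_of_isMaximalCompactSubgroup_of_exotic_of_sparse` + `inf_eq_bot_of_isMaximalCompactSubgroup_of_exotic_of_ne_of_sparse`
  (ISOLATION of exotic maximal compact subgroups), `verticial_of_isMaximalCompactSubgroup_of_ne_of_sparse`
  (SENTENCE 2: distinct maximal compact subgroups meeting non-trivially are verticial, with edge-like intersection).

So in the cell's ∀-countable typing any failure of sentence 2 of Thm 3.7 (iv) needs two ADJACENT base vertices of
infinite valence (F8).  Honest framing: statements about OUR typed `π₁^temp` at OUR typed carriers; print's Thm 3.7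
concerns the graphs of [SemiAnbd] (the IUT chain's dual graphs are finite); nothing here bears on [IUTchIII]
Cor. 3.12; no side taken; typed ≠ proved.
-/
noncomputable section

open CategoryTheory Topology

namespace Literature.AnabelianGeometry.SemiGraphs

open SimpleGraph

universe u

namespace ProfiniteSemiGraph

variable {𝒢 : ProfiniteSemiGraph.{u}}

/-! ### ★★ Sparse graphs: jointly compact or anchored -/

section Sparse

variable (h37 : 𝒢.Thm37Hypotheses)
  (hsp : ∀ (b b' : 𝒢.graph.Branch) (v v' : 𝒢.graph.Vertex), b ≠ b' → 𝒢.graph.edgeOf b = 𝒢.graph.edgeOf b' →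
    𝒢.graph.abuts b = some v → 𝒢.graph.abuts b' = some v' →
    {c : 𝒢.graph.Branch | 𝒢.graph.abuts c = some v}.Finite ∨ {c : 𝒢.graph.Branch | 𝒢.graph.abuts c = some v'}.Finite)

include hsp

/-- ★★ **At a SPARSE Thm-3.7 graph, two compact subgroups of `π₁^temp(𝒢)` meeting non-trivially generate a
compact subgroup or are ANCHORED** (`K₁`, `K₂` in verticial subgroups, `K₁ ⊓ K₂` in an edge-like subgroup).
Sparse: of the two vertices of any closed edge at least one has finitely many branches.  Proof: a level `m`
without common fixed vertex (F1); if every level `M ≥ m` carries a bridge, F2; otherwise bridges fail from some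
`M₀ ≥ m` on (a bridge descends along the transitions), every level `M ≥ M₀` carries a two-step configuration over
a vertex of infinite valence (F8: the alternative would be two adjacent infinite-valence base vertices), and
`anchored_of_forall_exists_twoStep` applies. [cite: MochizukiSemiAnbd2006, Thm 3.7(iv) p.41] -/
theorem isCompact_or_anchored_of_sparse
    (K₁ K₂ : Subgroup ((𝒢.galoisLevelData h37.toProp36Hypotheses).temperedPi h37.toProp36Hypotheses.isCountable))
    (hK₁ : IsCompact (K₁ : Set ((𝒢.galoisLevelData h37.toProp36Hypotheses).temperedPi
      h37.toProp36Hypotheses.isCountable)))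
    (hK₂ : IsCompact (K₂ : Set ((𝒢.galoisLevelData h37.toProp36Hypotheses).temperedPi
      h37.toProp36Hypotheses.isCountable)))
    (hne : K₁ ⊓ K₂ ≠ ⊥) :
    IsCompact (((K₁ ⊔ K₂).topologicalClosure :
      Subgroup ((𝒢.galoisLevelData h37.toProp36Hypotheses).temperedPi h37.toProp36Hypotheses.isCountable)) :
        Set ((𝒢.galoisLevelData h37.toProp36Hypotheses).temperedPi h37.toProp36Hypotheses.isCountable)) ∨
    ((∃ (v : 𝒢.graph.Vertex) (H : Subgroup (𝒢.temperedPiChart h37.toProp36Hypotheses).G),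
        H ∈ verticialSubgroups (𝒢.temperedPiChart h37.toProp36Hypotheses) v ∧ K₁ ≤ H) ∧
      (∃ (v : 𝒢.graph.Vertex) (H : Subgroup (𝒢.temperedPiChart h37.toProp36Hypotheses).G),
        H ∈ verticialSubgroups (𝒢.temperedPiChart h37.toProp36Hypotheses) v ∧ K₂ ≤ H) ∧
      ∃ (e : 𝒢.graph.Edge) (L : Subgroup (𝒢.temperedPiChart h37.toProp36Hypotheses).G),
        L ∈ edgeLikeSubgroups (𝒢.temperedPiChart h37.toProp36Hypotheses) e ∧ K₁ ⊓ K₂ ≤ L) := by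
  classical
  have h36 := h37.toProp36Hypotheses
  let Dg := 𝒢.galoisLevelData h36
  have hc := h36.isCountable
  let D₀ : VerticialLevelData.{0} 𝒢 (𝒢.temperedPiChart h36) := verticialLevelData_temperedPiChart (h36 := h36)
  by_cases hK : IsCompact (((K₁ ⊔ K₂).topologicalClosure : Subgroup (Dg.temperedPi hc)) : Set (Dg.temperedPi hc))
  · exact Or.inl hK
  right
  -- some level `m` without a common fixed vertex (F1)
  obtain ⟨m, hm⟩ : ∃ m : ℕ, ∀ z : (Dg.tree m).Vertex,
      (∀ k ∈ K₁, (Dg.treeAct hc m k).hom.vertexMap z = z) → ¬ ∀ k ∈ K₂, (Dg.treeAct hc m k).hom.vertexMap z = z := by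
    by_contra h
    push Not at h
    exact hK (isCompact_topologicalClosure_sup_of_forall_exists_common_fixed_vertex h36 K₁ K₂
      fun m => by obtain ⟨z, hz₁, hz₂⟩ := h m; exact ⟨z, hz₁, hz₂⟩)
  by_cases hbr : ∀ M : ℕ, m ≤ M → ∃ (x y : (Dg.tree M).Vertex) (β₁ β₂ : (Dg.tree M).Branch), β₁ ≠ β₂ ∧
      (Dg.tree M).edgeOf β₁ = (Dg.tree M).edgeOf β₂ ∧ (Dg.tree M).abuts β₁ = some x ∧ (Dg.tree M).abuts β₂ = some y ∧
      (∀ k ∈ K₁, (Dg.treeAct hc M k).hom.vertexMap x = x) ∧ ∀ k ∈ K₂, (Dg.treeAct hc M k).hom.vertexMap y = y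
  · -- bridges at every level `M ≥ m`: the anchored regime (F2)
    obtain ⟨h₁, h₂⟩ := exists_verticial_ge_of_forall_exists_bridge h36 K₁ K₂ m hm hbr
    exact ⟨h₁, h₂, exists_edgeLike_ge_inf_of_forall_exists_bridge h36 K₁ K₂ m hm hbr⟩
  -- some level `M₀ ≥ m` without a bridge; then no level `M ≥ M₀` carries a bridge (bridges descend)
  push Not at hbr
  obtain ⟨M₀, hmM₀, hnobr₀⟩ := hbr
  have hno₀ : ∀ z : (Dg.tree M₀).Vertex, (∀ k ∈ K₁, (Dg.treeAct hc M₀ k).hom.vertexMap z = z) →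
      ¬ ∀ k ∈ K₂, (Dg.treeAct hc M₀ k).hom.vertexMap z = z :=
    fun z hz => forall_not_common_fixed_of_le h36 K₁ K₂ hmM₀ hm z hz
  have hpushV : ∀ (K : Subgroup (Dg.temperedPi hc)) {M M' : ℕ} (h : M ≤ M') (w : (Dg.tree M').Vertex),
      (∀ k ∈ K, (Dg.treeAct hc M' k).hom.vertexMap w = w) →
      ∀ k ∈ K, (Dg.treeAct hc M k).hom.vertexMap ((Dg.treeTrans h).vertexMap w) = (Dg.treeTrans h).vertexMap w := by
    intro K M M' h w hw k hk
    have e : (Dg.treeTrans h).vertexMap ((Dg.treeAct hc M' k).hom.vertexMap w) =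
        (Dg.treeAct hc M k).hom.vertexMap ((Dg.treeTrans h).vertexMap w) := D₀.trans_act_vertexMap h k w
    rw [hw k hk] at e
    exact e.symm
  have hnobr : ∀ M : ℕ, M₀ ≤ M → ¬ ∃ (x y : (Dg.tree M).Vertex) (β₁ β₂ : (Dg.tree M).Branch), β₁ ≠ β₂ ∧
      (Dg.tree M).edgeOf β₁ = (Dg.tree M).edgeOf β₂ ∧ (Dg.tree M).abuts β₁ = some x ∧ (Dg.tree M).abuts β₂ = some y ∧
      (∀ k ∈ K₁, (Dg.treeAct hc M k).hom.vertexMap x = x) ∧ ∀ k ∈ K₂, (Dg.treeAct hc M k).hom.vertexMap y = y := by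
    rintro M hM ⟨x, y, β₁, β₂, h12, he, hx, hy, hxK, hyK⟩
    let π := Dg.treeTrans hM
    obtain ⟨k, hk, hne'⟩ := hnobr₀ (π.vertexMap x) (π.vertexMap y) (π.branchMap β₁) (π.branchMap β₂)
      (fun h => h12 (π.branchMap_injOn _ _ he h)) (by rw [π.edgeOf_branchMap, π.edgeOf_branchMap, he])
      (π.abuts_branchMap _ _ hx) (π.abuts_branchMap _ _ hy) (hpushV K₁ hM x hxK)
    exact hne' (hpushV K₂ hM y hyK k hk)
  -- a two-step configuration at every level `M ≥ M₀` (F8 + sparseness)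
  have htwo : ∀ M : ℕ, M₀ ≤ M → ∃ (x z y : (Dg.tree M).Vertex) (β₁ β₁' β₂ β₂' : (Dg.tree M).Branch),
      β₁ ≠ β₁' ∧ (Dg.tree M).edgeOf β₁ = (Dg.tree M).edgeOf β₁' ∧
      (Dg.tree M).abuts β₁ = some x ∧ (Dg.tree M).abuts β₁' = some z ∧
      β₂ ≠ β₂' ∧ (Dg.tree M).edgeOf β₂ = (Dg.tree M).edgeOf β₂' ∧
      (Dg.tree M).abuts β₂ = some z ∧ (Dg.tree M).abuts β₂' = some y ∧
      (∀ k ∈ K₁, (Dg.treeAct hc M k).hom.vertexMap x = x) ∧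
      (∀ k ∈ K₂, (Dg.treeAct hc M k).hom.vertexMap y = y) ∧
      (¬ ∀ k ∈ K₁, (Dg.treeAct hc M k).hom.vertexMap z = z) ∧
      ¬ ∀ k ∈ K₂, (Dg.treeAct hc M k).hom.vertexMap z = z := by
    intro M hM
    have hnoM : ∀ z : (Dg.tree M).Vertex, (∀ k ∈ K₁, (Dg.treeAct hc M k).hom.vertexMap z = z) →
        ¬ ∀ k ∈ K₂, (Dg.treeAct hc M k).hom.vertexMap z = z :=
      fun z hz => forall_not_common_fixed_of_le h36 K₁ K₂ hM hno₀ z hz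
    rcases exists_twoStep_or_adjacent_infinite_valence h37 K₁ K₂ hK₁ hK₂ hne M hnoM (hnobr M hM) with
      ⟨x, z, y, β₁, β₁', β₂, β₂', h11, he₁, hβ₁, hβ₁', h22, he₂, hβ₂, hβ₂', hx, hy, hz₁, hz₂, -⟩ |
      ⟨b, b', v, v', hbb, he, hb, hb', hv, hv'⟩
    · exact ⟨x, z, y, β₁, β₁', β₂, β₂', h11, he₁, hβ₁, hβ₁', h22, he₂, hβ₂, hβ₂', hx, hy, hz₁, hz₂⟩
    · exact absurd (hsp b b' v v' hbb he hb hb') (not_or.mpr ⟨hv, hv'⟩)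
  exact anchored_of_forall_exists_twoStep h36 K₁ K₂ M₀ hno₀ hnobr htwo

/-! ### ★★ The three ∀-pieces of Thm 3.7 (iv) OUTRIGHT at sparse graphs -/

/-- ★★ **ANCHORED PACKAGE at a sparse graph**: a compact subgroup `K` of `π₁^temp(𝒢)` meeting a VERTICIAL
subgroup `H` non-trivially lies in SOME verticial subgroup — no exotic compact subgroup meets a verticial subgroup
non-trivially (if `(H ⊔ K)‾` is compact it contains the maximal compact `H`, abc-iut-w6-d064's
`eq_of_verticial_le_compact`, so `K ≤ H`; otherwise `isCompact_or_anchored_of_sparse`).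
[cite: MochizukiSemiAnbd2006, Thm 3.7(iv) p.41] -/
theorem exists_verticial_ge_of_inf_verticial_ne_bot_of_sparse {v : 𝒢.graph.Vertex}
    (H K : Subgroup ((𝒢.galoisLevelData h37.toProp36Hypotheses).temperedPi h37.toProp36Hypotheses.isCountable))
    (hH : H ∈ verticialSubgroups (𝒢.temperedPiChart h37.toProp36Hypotheses) v)
    (hK : IsCompact (K : Set ((𝒢.galoisLevelData h37.toProp36Hypotheses).temperedPi
      h37.toProp36Hypotheses.isCountable)))
    (hne : H ⊓ K ≠ ⊥) :
    ∃ (w : 𝒢.graph.Vertex) (H' : Subgroup (𝒢.temperedPiChart h37.toProp36Hypotheses).G),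
      H' ∈ verticialSubgroups (𝒢.temperedPiChart h37.toProp36Hypotheses) w ∧ K ≤ H' := by
  have h36 := h37.toProp36Hypotheses
  have hHc : IsCompact (H : Set ((𝒢.galoisLevelData h36).temperedPi h36.isCountable)) :=
    isCompact_of_mem_verticialSubgroups (𝒢.temperedPiChart h36) hH
  rcases isCompact_or_anchored_of_sparse h37 hsp H K hHc hK hne with hcpt | ⟨-, hK', -⟩
  · have hle : H ≤ (H ⊔ K).topologicalClosure := le_sup_left.trans (Subgroup.le_topologicalClosure _)
    have heq := eq_of_verticial_le_compact h37 (𝒢.temperedPiChart h36) hH hcpt hle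
    exact ⟨v, H, hH, (le_sup_right.trans (Subgroup.le_topologicalClosure _)).trans heq.le⟩
  · exact hK'

/-- ★★ **ISOLATION at a sparse graph**: a compact subgroup `K` meeting an EXOTIC maximal compact subgroup `K₀` (one
lying in no verticial subgroup) non-trivially lies in `K₀` (if `(K ⊔ K₀)‾` is compact it equals `K₀` by
maximality; the anchored alternative would put `K₀` in a verticial subgroup). [cite: MochizukiSemiAnbd2006, Thm 3.7(iv) p.41] -/
theorem le_of_isMaximalCompactSubgroup_of_exotic_of_sparse
    (K K₀ : Subgroup ((𝒢.galoisLevelData h37.toProp36Hypotheses).temperedPi h37.toProp36Hypotheses.isCountable))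
    (hK : IsCompact (K : Set ((𝒢.galoisLevelData h37.toProp36Hypotheses).temperedPi
      h37.toProp36Hypotheses.isCountable)))
    (hK₀ : IsMaximalCompactSubgroup K₀)
    (hK₀ex : ∀ (w : 𝒢.graph.Vertex) (H' : Subgroup (𝒢.temperedPiChart h37.toProp36Hypotheses).G),
      H' ∈ verticialSubgroups (𝒢.temperedPiChart h37.toProp36Hypotheses) w → ¬ K₀ ≤ H')
    (hne : K ⊓ K₀ ≠ ⊥) : K ≤ K₀ := by
  rcases isCompact_or_anchored_of_sparse h37 hsp K K₀ hK hK₀.1 hne with hcpt | ⟨-, ⟨w, H', hH', hK₀H'⟩, -⟩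
  · have hle₀ : K₀ ≤ (K ⊔ K₀).topologicalClosure := le_sup_right.trans (Subgroup.le_topologicalClosure _)
    have heq := hK₀.2 _ hcpt hle₀
    exact (le_sup_left.trans (Subgroup.le_topologicalClosure _)).trans heq.le
  · exact absurd hK₀H' (hK₀ex w H' hH')

/-- ★★ **An exotic maximal compact subgroup of a sparse graph meets every OTHER maximal compact subgroup trivially.**
[cite: MochizukiSemiAnbd2006, Thm 3.7(iv) p.41] -/
theorem inf_eq_bot_of_isMaximalCompactSubgroup_of_exotic_of_ne_of_sparse
    (K K₀ : Subgroup ((𝒢.galoisLevelData h37.toProp36Hypotheses).temperedPi h37.toProp36Hypotheses.isCountable))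
    (hK : IsMaximalCompactSubgroup K) (hK₀ : IsMaximalCompactSubgroup K₀)
    (hK₀ex : ∀ (w : 𝒢.graph.Vertex) (H' : Subgroup (𝒢.temperedPiChart h37.toProp36Hypotheses).G),
      H' ∈ verticialSubgroups (𝒢.temperedPiChart h37.toProp36Hypotheses) w → ¬ K₀ ≤ H')
    (hKK₀ : K ≠ K₀) : K ⊓ K₀ = ⊥ := by
  by_contra hne
  have hle : K ≤ K₀ := le_of_isMaximalCompactSubgroup_of_exotic_of_sparse h37 hsp K K₀ hK.1 hK₀ hK₀ex hne
  exact hKK₀ (hK.2 K₀ hK₀.1 hle).symm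

/-- ★★ **THM 3.7 (iv), SECOND SENTENCE, at a sparse graph**: two DISTINCT maximal compact subgroups of `π₁^temp(𝒢)`
meeting non-trivially are BOTH VERTICIAL and their intersection lies in an EDGE-LIKE subgroup (two distinct maximal
compact subgroups never generate a compact subgroup; in the anchored regime maximality makes each equal to the
verticial subgroup containing it). [cite: MochizukiSemiAnbd2006, Thm 3.7(iv) p.41] -/
theorem verticial_of_isMaximalCompactSubgroup_of_ne_of_sparse
    (K₁ K₂ : Subgroup ((𝒢.galoisLevelData h37.toProp36Hypotheses).temperedPi h37.toProp36Hypotheses.isCountable))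
    (hK₁ : IsMaximalCompactSubgroup K₁) (hK₂ : IsMaximalCompactSubgroup K₂) (hne₁₂ : K₁ ≠ K₂)
    (hne : K₁ ⊓ K₂ ≠ ⊥) :
    (∃ v : 𝒢.graph.Vertex, K₁ ∈ verticialSubgroups (𝒢.temperedPiChart h37.toProp36Hypotheses) v) ∧
      (∃ v : 𝒢.graph.Vertex, K₂ ∈ verticialSubgroups (𝒢.temperedPiChart h37.toProp36Hypotheses) v) ∧
      ∃ (e : 𝒢.graph.Edge) (L : Subgroup (𝒢.temperedPiChart h37.toProp36Hypotheses).G),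
        L ∈ edgeLikeSubgroups (𝒢.temperedPiChart h37.toProp36Hypotheses) e ∧ K₁ ⊓ K₂ ≤ L := by
  rcases isCompact_or_anchored_of_sparse h37 hsp K₁ K₂ hK₁.1 hK₂.1 hne with
    hcpt | ⟨⟨v₁, H₁, hH₁, hK₁H₁⟩, ⟨v₂, H₂, hH₂, hK₂H₂⟩, hedge⟩
  · have h₁ := hK₁.2 _ hcpt (le_sup_left.trans (Subgroup.le_topologicalClosure _))
    have h₂ := hK₂.2 _ hcpt (le_sup_right.trans (Subgroup.le_topologicalClosure _))
    exact absurd (h₁.symm.trans h₂) hne₁₂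
  · have h₁ : K₁ = H₁ := le_antisymm hK₁H₁ ((hK₁.2 H₁ (isCompact_of_mem_verticialSubgroups _ hH₁) hK₁H₁).le)
    have h₂ : K₂ = H₂ := le_antisymm hK₂H₂ ((hK₂.2 H₂ (isCompact_of_mem_verticialSubgroups _ hH₂) hK₂H₂).le)
    exact ⟨⟨v₁, h₁ ▸ hH₁⟩, ⟨v₂, h₂ ▸ hH₂⟩, hedge⟩

end Sparse

/-- **Locally finite graphs are sparse** (the binder of this file), so F4's `isCompact_or_anchored_of_isLocallyFinite`
is the special case of `isCompact_or_anchored_of_sparse`. [cite: MochizukiSemiAnbd2006, Thm 3.7(iv) p.41] -/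
theorem sparse_of_isLocallyFinite (hlf : 𝒢.graph.IsLocallyFinite) :
    ∀ (b b' : 𝒢.graph.Branch) (v v' : 𝒢.graph.Vertex), b ≠ b' → 𝒢.graph.edgeOf b = 𝒢.graph.edgeOf b' →
      𝒢.graph.abuts b = some v → 𝒢.graph.abuts b' = some v' →
      {c : 𝒢.graph.Branch | 𝒢.graph.abuts c = some v}.Finite ∨
        {c : 𝒢.graph.Branch | 𝒢.graph.abuts c = some v'}.Finite :=
  fun _ _ v _ _ _ _ _ => Or.inl (𝒢.finite_branches_of_isLocallyFinite hlf v)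

end ProfiniteSemiGraph

end Literature.AnabelianGeometry.SemiGraphs

end
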